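import Summits.Ventures.Crystal3D.Theorems.StickyWulffConstantCoaxialWallLawPayerTransPlaneRow
import Summits.Ventures.Crystal3D.Theorems.StickyWulffConstantCoaxialWallLawPayerUnionTwoPlate
import Summits.Ventures.Crystal3D.Theorems.StickyWulffConstantCoaxialWallLawVicinalSplit
import Summits.Ventures.Crystal3D.Theorems.StickyWulffConstantCoaxialWallLawForeignTilt
import Summits.Ventures.Crystal3D.Theorems.StickyWulffConstantCoaxialWallLawTriadicRegistryCoaxial
import HarnessLib

/-!
# Debt 2 of the vicinal split, `CoaxialTwoSlabAdhesionCoherentFault`, FROM THE IN-PLANE TRANSLATION ROW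

HONEST FRAMING. Venture `Summits/Ventures/Crystal3D` (cell `crystal3d-full`), helper `--supports` the crux
`CoaxialWallLaw` (stmt-Ventures-19481, `route-Ventures-StickyWulffConstant`), REGISTERED line `WallLedgerF`, open stub
`stub_coaxialTwoSlabAdhesion`.  Rung credit; F-C1 not moved; CONDITIONAL on named facts.  cf-p1 g28 16:52/16:59Z
(19481-p2 g6): the cubic-coordinate lemma «coherent fault coset ⇒ class (C)» and Debt 2 of 19481-p1 g11's split
(`…VicinalSplit`): a COHERENT FAULT pair (`A₂·Λ₀ = A₁·Λ₀`, offset `τ ∈ Λ₀ + a·√(2/3)·m`, `m` a model `{111}` normal with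
cubic signs `ε ∈ {±1}³`, `3 ∤ a` since `Λ₁ ≠ Λ₂`) has `√2·cc(τ) = ℓ + (2a/3)·ε` with `ℓ ∈ ℤ³`, so
`ε_k p_k + ε_i p_i ≡ 4a/3 ∉ ℤ`: the cube condition of `exists_skewFrame_of_cube` for the sign vector `ε` — the pair is
class (C) for the fault plane, and `coaxialTwoSlabAdhesion_trans_skew_row` (`…PayerTransPlaneRow`) gives the stub's
conclusion at `(√6/s_F)·sin θ' ≥ ½·sin θ'`.

* `cube_of_coherentFault` (the cubic lemma), **`coaxialTwoSlabAdhesionCoherentFault_of_row`** :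
  `KissingGap δ → KissingClassification δ → 0 < s_F ≤ 2√6 → EndRowTrans v1 s_F → CoaxialTwoSlabAdhesionCoherentFault`.

INPUTS BY NAME: `KissingGap`, `KissingClassification`, the census Prop `EndRowTrans WordVersion.v1 s_F` (`…EndRowDefs`).
WHAT THIS IS NOT: not the row; Debts 1, 3 elsewhere; F-C1 not moved.
-/

noncomputable section

namespace Summit.Ventures.Crystal3D.Theorems

open Summit.Ventures.Crystal3D Finset NearIdentity
open Literature.MathematicalPhysics.StatisticalMechanics (fccStacking barlowStacking IsHaggSeq constHagg
  isHaggSeq_const contactDeficiency)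
open scoped InnerProductSpace

/-- **Coherent fault offsets are class (C).**  If `τ − a·√(2/3)·μ ∈ Λ₀` for a model menu normal `μ` and `τ ∉ Λ₀`, then for
the cube sign vector of `μ` no two signed cubic coordinates of `τ` sum to an integer. -/
theorem cube_of_coherentFault {τ μ : EuclideanSpace ℝ (Fin 3)} (hμ1 : ‖μ‖ = 1)
    (hμmenu : ∀ w ∈ fccSlots, ⟪w, μ⟫_ℝ = 0 ∨ ⟪w, μ⟫_ℝ = Real.sqrt (2 / 3) ∨ ⟪w, μ⟫_ℝ = -Real.sqrt (2 / 3))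
    {a : ℤ} (ha : τ - (a : ℝ) • (Real.sqrt (2 / 3) • μ) ∈ fccStacking 1 (Real.sqrt (2 / 3)))
    (hτ : τ ∉ fccStacking 1 (Real.sqrt (2 / 3))) :
    ∃ c : Fin 8, ∀ k i : Fin 3, k ≠ i → ¬ ∃ z : ℤ,
      (cubeInt c k : ℝ) * (Real.sqrt 2 * cubicCoords τ k) + (cubeInt c i : ℝ) * (Real.sqrt 2 * cubicCoords τ i) = z := by
  -- the cubic signs of `μ` (read in the identity frame)
  obtain ⟨k, hk1, hk⟩ := menu_cubic_coords_pm_one (LinearIsometryEquiv.refl ℝ (EuclideanSpace ℝ (Fin 3))) hμ1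
    (fun w hw => by simpa using hμmenu w hw)
  have hccμ : ∀ j, Real.sqrt 3 * cubicCoords μ j = k j := by
    intro j
    rw [← inner_cubicFrame, real_inner_comm, mul_comm]
    simpa using hk j
  -- integer cubic coordinates of the lattice part
  obtain ⟨l0, l1, l2, hle, hl0, hl1, hl2⟩ := exists_even_cubic_of_mem_fcc ha
  set l : Fin 3 → ℤ := ![l0, l1, l2] with hl
  have hlj : ∀ j, Real.sqrt 2 * cubicCoords (τ - (a : ℝ) • (Real.sqrt (2 / 3) • μ)) j = l j := by
    intro j; fin_cases j
    · simpa [hl] using hl0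
    · simpa [hl] using hl1
    · simpa [hl] using hl2
  have h23 : Real.sqrt 2 * Real.sqrt (2 / 3) = 2 / Real.sqrt 3 := by
    rw [Real.sqrt_div (by norm_num : (0:ℝ) ≤ 2), ← mul_div_assoc, Real.mul_self_sqrt (by norm_num : (0:ℝ) ≤ 2)]
  have h3 : Real.sqrt 3 ≠ 0 := by positivity
  have hp : ∀ j, Real.sqrt 2 * cubicCoords τ j = l j + 2 * a * k j / 3 := by
    intro j
    have e : τ = (τ - (a : ℝ) • (Real.sqrt (2 / 3) • μ)) + (a : ℝ) • (Real.sqrt (2 / 3) • μ) := by abel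
    have hkj : cubicCoords μ j = k j / Real.sqrt 3 := by
      rw [eq_div_iff h3, mul_comm]; exact hccμ j
    rw [e, cubicCoords_add, Pi.add_apply, mul_add, hlj, cubicCoords_smul, Pi.smul_apply, smul_eq_mul, cubicCoords_smul,
      Pi.smul_apply, smul_eq_mul, hkj]
    have h33 : Real.sqrt 3 * Real.sqrt 3 = 3 := Real.mul_self_sqrt (by norm_num)
    have : Real.sqrt 2 * ((a : ℝ) * (Real.sqrt (2 / 3) * ((k j : ℝ) / Real.sqrt 3))) =
        (Real.sqrt 2 * Real.sqrt (2 / 3)) * a * k j / Real.sqrt 3 := by ring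
    rw [this, h23, div_mul_eq_mul_div, div_mul_eq_mul_div, div_div, h33]
  -- the cube vector with the signs `k`
  have hkR : ∀ j, (k j : ℝ) = 1 ∨ (k j : ℝ) = -1 := fun j => by
    rcases hk1 j with h | h
    · left; exact_mod_cast h
    · right; exact_mod_cast h
  obtain ⟨c, hc0, hc1, hc2⟩ := exists_cubeInt_eq (k 0) (k 1) (k 2) (hkR 0) (hkR 1) (hkR 2)
  have hcj : ∀ j, (cubeInt c j : ℝ) = k j := by
    intro j; fin_cases j
    · exact hc0
    · exact hc1
    · exact hc2
  have hsq : ∀ j, ((k j : ℝ)) ^ 2 = 1 := fun j => by rcases hkR j with h | h <;> rw [h] <;> norm_num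
  refine ⟨c, fun k' i hki => ?_⟩
  rintro ⟨z, hz⟩
  rw [hcj, hcj, hp, hp] at hz
  have e1 : (k k' : ℝ) * (l k' + 2 * a * k k' / 3) = k k' * l k' + 2 * a / 3 := by
    have h := hsq k'
    linear_combination (2 * (a : ℝ) / 3) * h
  have e2 : (k i : ℝ) * (l i + 2 * a * k i / 3) = k i * l i + 2 * a / 3 := by
    have h := hsq i
    linear_combination (2 * (a : ℝ) / 3) * h
  rw [e1, e2] at hz
  -- `4a = 3 (z − k ℓ − k ℓ)`, so `3 ∣ a`
  have hdiv : (4 * a : ℤ) = 3 * (z - k k' * l k' - k i * l i) := by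
    have : (4 * a : ℝ) = 3 * ((z : ℝ) - k k' * l k' - k i * l i) := by linarith
    exact_mod_cast this
  obtain ⟨b, hb⟩ : (3 : ℤ) ∣ a := by omega
  -- then `τ ∈ Λ₀`: integer cubic coordinates `ℓ + 2b·k` with even sum
  apply hτ
  have hpj : ∀ j, Real.sqrt 2 * cubicCoords τ j = ((l j + 2 * b * k j : ℤ) : ℝ) := by
    intro j; rw [hp j, hb]; push_cast; ring
  obtain ⟨e0, e1', e2'⟩ := sqrt_two_mul_cubicCoords τ
  refine mem_fcc_of_cubic_int τ (l 0 + 2 * b * k 0) (l 1 + 2 * b * k 1) (l 2 + 2 * b * k 2) ?_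
    (by rw [← e0, hpj]) (by rw [← e1', hpj]) (by rw [← e2', hpj])
  have hle' : Even (l 0 + l 1 + l 2) := by simpa [hl] using hle
  have : l 0 + 2 * b * k 0 + (l 1 + 2 * b * k 1) + (l 2 + 2 * b * k 2) =
      (l 0 + l 1 + l 2) + 2 * (b * (k 0 + k 1 + k 2)) := by ring
  rw [this]
  exact hle'.add (even_two_mul _)

section Row

variable {δ : ℝ} (hg : KissingGap δ) (hc : KissingClassification δ)
variable {sF : ℝ} (hsF : 0 < sF) (hsF' : sF ≤ 2 * Real.sqrt 6) (hrowT : EndRowTrans WordVersion.v1 sF)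
include hg hc hsF hsF' hrowT

open scoped Classical in
/-- **Debt 2 from the in-plane translation row.**  See the module docstring. -/
theorem coaxialTwoSlabAdhesionCoherentFault_of_row : CoaxialTwoSlabAdhesionCoherentFault := by
  intro A₁ t₁ A₂ t₂ hcoax hne hS
  obtain ⟨-, hΛ₂, n, hn1, hmenu, a, ha⟩ := hS
  have htrans : A₁ '' fccStacking 1 (Real.sqrt (2 / 3)) = A₂ '' fccStacking 1 (Real.sqrt (2 / 3)) := hΛ₂.symm
  set e₃ : EuclideanSpace ℝ (Fin 3) := EuclideanSpace.single (2 : Fin 3) (1 : ℝ) with he₃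
  set τ : EuclideanSpace ℝ (Fin 3) := A₁.symm (t₂ - t₁) with hτ
  have hτΛ : τ ∉ fccStacking 1 (Real.sqrt (2 / 3)) := offset_notMem_of_ne A₁ A₂ t₁ t₂ htrans hne
  -- the model normal `μ = A₁⁻¹ n`
  set μ : EuclideanSpace ℝ (Fin 3) := A₁.symm n with hμ
  have hAμ : A₁ μ = n := A₁.apply_symm_apply n
  have hμ1 : ‖μ‖ = 1 := by rw [hμ, LinearIsometryEquiv.norm_map, hn1]
  have hμmenu : ∀ w ∈ fccSlots, ⟪w, μ⟫_ℝ = 0 ∨ ⟪w, μ⟫_ℝ = Real.sqrt (2 / 3) ∨ ⟪w, μ⟫_ℝ = -Real.sqrt (2 / 3) := by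
    intro w hw
    have := hmenu w hw
    rwa [← hAμ, LinearIsometryEquiv.inner_map_map] at this
  have ha' : τ - (a : ℝ) • (Real.sqrt (2 / 3) • μ) ∈ fccStacking 1 (Real.sqrt (2 / 3)) := by
    have e : A₁.symm (t₂ - t₁ - (a : ℝ) • (Real.sqrt (2 / 3) • n)) = τ - (a : ℝ) • (Real.sqrt (2 / 3) • μ) := by
      rw [map_sub, LinearIsometryEquiv.map_smul, LinearIsometryEquiv.map_smul]
    rw [← e]; exact ha
  obtain ⟨c, hcube⟩ := cube_of_coherentFault hμ1 hμmenu ha' hτΛ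
  obtain ⟨L', hL', hskew⟩ := exists_skewFrame_of_cube A₁ τ c hcube
  obtain ⟨C, R₀, hR₀, hmain⟩ := coaxialTwoSlabAdhesion_trans_skew_row hg hc A₁ t₁ A₂ t₂ L' hL' htrans hskew hsF
    (hrowT L')
  refine ⟨L', t₁, t₂, constHagg, constHagg, isHaggSeq_const, isHaggSeq_const,
    movedFcc_subset_frame_of_image_eq A₁ L' t₁ hL'.symm,
    movedFcc_subset_frame_of_image_eq A₂ L' t₂ (hΛ₂.trans hL'.symm), C, R₀, hR₀, ?_⟩
  intro h hh ρ hρ X P₁ P₂ hX hP₁X hP₂X₁ hcyl hP₁ hP₂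
  have key := hmain h hh ρ hρ X P₁ P₂ hX hP₁X hP₂X₁ hcyl hP₁ hP₂
  have hhalf : (1 / 2 : ℝ) * Real.sqrt (1 - ⟪L' e₃, e₃⟫_ℝ ^ 2) ≤ Real.sqrt 6 / sF * Real.sqrt (1 - ⟪L' e₃, e₃⟫_ℝ ^ 2) := by
    refine mul_le_mul_of_nonneg_right ?_ (Real.sqrt_nonneg _)
    rw [le_div_iff₀ hsF]
    linarith only [hsF']
  have hπρ : 0 ≤ Real.pi * ρ ^ 2 := by positivity
  have := mul_le_mul_of_nonneg_right hhalf hπρ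
  linarith only [key, this]

end Row

end Summit.Ventures.Crystal3D.Theorems

end
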